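import Summits.QuantumFields.YangMills.Theorems.AlphaInputsT3ACv3AbelianSmall
import Literature.MathematicalPhysics.QuantumFieldTheory.Balaban1983to89.B10Eq38TorusDomains
import HarnessLib

/-!
# `AlphaInputsT3ACv3LinearLiftGauge` — (LL) STEP L3: THE (0.4) LINEAR AVERAGE OF A PURE GAUGE IS THE GAUGE AT THE BLOCK CENTRES, AND THE ITERATED AVERAGE IS THE
# TRANSPORTED-SEGMENT MEAN UP TO A COBOUNDARY — cell `ym3-torus`, width seat `ym-ust-19936-w2` (g0), OWNER re-point 2026-08-27T23:08Z

WHY.  The exact linear lift of plan L1–L5 (HOME `ym3-torus/ym-ust-19936-w2/LL-PLAN-w2-g0.md`) is `a := S¹A + dg`: the spreading `S¹A` has EXACT transported-segment means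
(`M^k S¹A = A`, profiles of `AlphaInputsT3ACv3LinearLiftProfile`), and the one-form `linAvgIter k` of alpha-2's `AbelianEML` differs from the `k`-fold segment mean by a
COBOUNDARY (`linAvg04_eq`: `linAvg04 a c = segMean a c + Φ(c₋) − Φ(c₊)`).  This file supplies the two gauge facts that absorb that coboundary:
* §1 `dgrad g` (the gradient of a 0-form), `wsum_dgrad` (walk sums of a gradient telescope), `stairSum_dgrad`, `segSum_dgrad`, `ptMean` (block mean of a 0-form over the
  offset points), `stairMean_dgrad = ptMean − g ∘ emb`, `segMean_dgrad = d(ptMean)`.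
* §2 ★ `linAvg04_dgrad : linAvg04 (dgrad g) = dgrad (g ∘ emb)` — the (0.4) linear average of a pure gauge is the pure gauge READ AT THE BLOCK CENTRES; ★ `linAvgIter_dgrad :
  linAvgIter s (dgrad g) = dgrad (g ∘ toFine s)`.
* §3 linearity (`wsum_sub`, `segMean_sub`, `stairMean_sub`, `linAvg04_sub`), the segment-mean operator `segOp`∕`segIter` (`M`, `M^s`) and the coboundary potential
  `psiIter` (`Ψ_s`), and ★★ `linAvgIter_eq_segIter_sub : linAvgIter s a = segIter s a − dgrad (psiIter s a)` — so exactness of the `k`-fold (0.4)-linear averages reduces to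
  exactness of the `k`-fold SEGMENT means plus a gradient correction read at the centres (`linAvgIter_dgrad`); the assembly `a := S¹A + dgrad(Ψ_k(S¹A) ∘ coarsen k)` is file L4.
HONEST FRAMING.  Linear bookkeeping over alpha-2's `AbelianEML` calculus; nothing of [Balaban1987RG1]∕[Balaban1985UV3] is asserted; count-neutral helper toward the (FL) row of
2′∕2′χ (`--supports stmt-QuantumFields-19936`); registry untouched.  YM₃ on the torus is a RUNG of the programme, not the Clay problem; no claim about d = 4, infinite volume
or a mass gap.

References: T. Bałaban, Commun. Math. Phys. 109 (1987) 249–301 [Balaban1987RG1] ((0.3)–(0.4) pp.252–253, (0.11) p.253); Commun. Math. Phys. 102 (1985) 255–275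
[Balaban1985UV3] ((38) p.266: the inclusions `T^{(j)} ⊂ T_η`, `toFine`).
-/

set_option autoImplicit false

noncomputable section

namespace Summit.QuantumFields.YangMills.Theorems.LinearLiftGauge

open Literature.MathematicalPhysics.QuantumFieldTheory.Balaban1983to89
open Literature.MathematicalPhysics.QuantumFieldTheory.Balaban1983to89.T4Continuum
open Literature.MathematicalPhysics.QuantumFieldTheory.Balaban1983to89.BlockAveraging (off Idx)
open Literature.MathematicalPhysics.QuantumFieldTheory.Balaban1983to89.BlockAveragingEMLProp2 (walkEnd_stairWord_replicate)
open Literature.MathematicalPhysics.QuantumFieldTheory.Balaban1983to89.B10Eq38TorusDomains (toFine toFine_zero toFine_succ)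
open Summit.QuantumFields.YangMills.Theorems.AbelianEML

variable {P : Params} {j : ℕ}

/-! ## §1 Gradients: walk sums telescope -/

/-- **THE GRADIENT OF A 0-FORM**: `(dg)(b) = g(b₊) − g(b₋)`. [folklore] -/
def dgrad (g : Site P j → ℝ) : PBond P j → ℝ := fun b => g b.tgt - g b.src

/-- `dgrad` is additive. [folklore] -/
theorem dgrad_add (g g' : Site P j → ℝ) : dgrad (g + g') = dgrad g + dgrad g' := by
  funext b; simp only [dgrad, Pi.add_apply]; ring

/-- `dgrad` commutes with subtraction. [folklore] -/
theorem dgrad_sub (g g' : Site P j → ℝ) : dgrad (g - g') = dgrad g - dgrad g' := by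
  funext b; simp only [dgrad, Pi.sub_apply]; ring

/-- **WALK SUMS OF A GRADIENT TELESCOPE**: `wsum (dg) x w = g(end of the walk) − g(x)`. [folklore] -/
theorem wsum_dgrad (g : Site P j → ℝ) : ∀ (w : List (Letter P.d)) (x : Site P j), wsum (dgrad g) x w = g (walkEnd x w) - g x
  | [], x => by simp [walkEnd]
  | (μ, true) :: w, x => by
    rw [wsum_cons_true, wsum_dgrad g w (x.shift μ)]
    simp only [dgrad, PBond.tgt, walkEnd]
    ring
  | (μ, false) :: w, x => by
    rw [wsum_cons_false, wsum_dgrad g w (x.unshift μ)]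
    simp only [dgrad, PBond.tgt, walkEnd, Site.shift_unshift]
    ring

/-- The staircase sum of a gradient: `g(offset point) − g(centre)`. [cite: Balaban1987RG1, (0.3) p.252] -/
theorem stairSum_dgrad (g : Site P j → ℝ) (y : Site P (j + 1)) (n : Fin P.d → ℤ) (σ : Equiv.Perm (Fin P.d)) :
    stairSum (dgrad g) y n σ = g (offPt y n) - g (emb y) := by
  unfold stairSum
  rw [wsum_dgrad, walkEnd_stairWord_offPt]

/-- The transported-segment sum of a gradient: `g(offset point of c₊) − g(offset point of c₋)`. [cite: Balaban1987RG1, (0.4) p.253] -/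
theorem segSum_dgrad (g : Site P j → ℝ) (c : PBond P (j + 1)) (n : Fin P.d → ℤ) :
    segSum (dgrad g) c.src n c.dir = g (offPt c.tgt n) - g (offPt c.src n) := by
  unfold segSum
  rw [wsum_dgrad]
  congr 2
  have h1 := walkEnd_stairWord_offPt (P := P) c.src (Equiv.refl _) n
  have h2 := walkEnd_stairWord_replicate (P := P) c.src c.dir (Equiv.refl _) (Equiv.refl _) n
  rw [h1] at h2
  rw [h2, PBond.tgt, walkEnd_stairWord_offPt]

/-- **THE BLOCK MEAN OF A 0-FORM** over the offset points of a block (mean over the index set `Idx`; the two orderings are idle). [cite: Balaban1987RG1, (0.3) p.252] -/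
def ptMean (g : Site P j → ℝ) (y : Site P (j + 1)) : ℝ :=
  (Fintype.card (Idx P) : ℝ)⁻¹ * ∑ i : Idx P, g (offPt y (off i.1))

/-- The index set is non-empty (as a real cardinality). [folklore] -/
theorem card_Idx_pos : (0 : ℝ) < Fintype.card (Idx P) := Nat.cast_pos.mpr Fintype.card_pos

/-- `Φ(dg)(y) = ptMean g y − g(emb y)`. [cite: Balaban1987RG1, (0.3) p.252] -/
theorem stairMean_dgrad (g : Site P j → ℝ) (y : Site P (j + 1)) : stairMean (dgrad g) y = ptMean g y - g (emb y) := by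
  unfold stairMean ptMean
  simp_rw [stairSum_dgrad]
  rw [Finset.sum_sub_distrib, Finset.sum_const, Finset.card_univ, nsmul_eq_mul, mul_sub, ← mul_assoc,
    inv_mul_cancel₀ (card_Idx_pos (P := P)).ne', one_mul]

/-- `segMean (dg) c = ptMean g c₊ − ptMean g c₋` (the segment mean of a gradient is the coarse gradient of the block mean). [cite: Balaban1987RG1, (0.4) p.253] -/
theorem segMean_dgrad (g : Site P j → ℝ) (c : PBond P (j + 1)) : segMean (dgrad g) c = ptMean g c.tgt - ptMean g c.src := by
  unfold segMean ptMean
  simp_rw [segSum_dgrad]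
  rw [Finset.sum_sub_distrib, mul_sub]

/-! ## §2 The (0.4) linear average of a pure gauge -/

/-- **★ THE (0.4) LINEAR AVERAGE OF A PURE GAUGE IS THE PURE GAUGE READ AT THE BLOCK CENTRES**: `linAvg04 (dg) = d(g ∘ emb)` — the transported-segment mean `d(ptMean g)` and the
coboundary `Φ(c₋) − Φ(c₊) = (ptMean g − g∘emb)(c₋) − (ptMean g − g∘emb)(c₊)` combine. [cite: Balaban1987RG1, (0.4) p.253] -/
theorem linAvg04_dgrad (g : Site P j → ℝ) : linAvg04 (dgrad g) = dgrad (g ∘ emb) := by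
  funext c
  rw [linAvg04_eq, segMean_dgrad, stairMean_dgrad, stairMean_dgrad]
  simp only [dgrad, Function.comp]
  ring

/-- **★ THE ITERATED LINEAR AVERAGE OF A PURE GAUGE**: `linAvgIter s (dg) = d(g ∘ toFine s)` (the gauge read at the `s`-fold centres). [cite: Balaban1987RG1, (0.11) p.253] -/
theorem linAvgIter_dgrad (g : Site P 0 → ℝ) : ∀ s : ℕ, linAvgIter s (dgrad g) = dgrad (g ∘ toFine s)
  | 0 => by funext b; rfl
  | s + 1 => by
    rw [linAvgIter_succ, linAvgIter_dgrad g s, linAvg04_dgrad]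
    rfl

/-! ## §3 Linearity, the segment-mean iteration and the coboundary potential -/

/-- Walk sums are linear: subtraction. [folklore] -/
theorem wsum_sub (a b : PBond P j → ℝ) : ∀ (w : List (Letter P.d)) (x : Site P j), wsum (a - b) x w = wsum a x w - wsum b x w
  | [], x => by simp
  | (μ, true) :: w, x => by rw [wsum_cons_true, wsum_cons_true, wsum_cons_true, wsum_sub a b w]; simp only [Pi.sub_apply]; ring
  | (μ, false) :: w, x => by rw [wsum_cons_false, wsum_cons_false, wsum_cons_false, wsum_sub a b w]; simp only [Pi.sub_apply]; ring

/-- `segMean` is linear: subtraction. [folklore] -/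
theorem segMean_sub (a b : PBond P j → ℝ) (c : PBond P (j + 1)) : segMean (a - b) c = segMean a c - segMean b c := by
  unfold segMean segSum
  simp_rw [wsum_sub]
  rw [Finset.sum_sub_distrib, mul_sub]

/-- `stairMean` is linear: subtraction. [folklore] -/
theorem stairMean_sub (a b : PBond P j → ℝ) (y : Site P (j + 1)) : stairMean (a - b) y = stairMean a y - stairMean b y := by
  unfold stairMean stairSum
  simp_rw [wsum_sub]
  rw [Finset.sum_sub_distrib, mul_sub]

/-- `linAvg04` is linear: subtraction. [cite: Balaban1987RG1, (0.4) p.253] -/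
theorem linAvg04_sub (a b : PBond P j → ℝ) : linAvg04 (a - b) = linAvg04 a - linAvg04 b := by
  funext c
  rw [Pi.sub_apply, linAvg04_eq, linAvg04_eq, linAvg04_eq, segMean_sub, stairMean_sub, stairMean_sub]
  ring

/-- **THE TRANSPORTED-SEGMENT MEAN AS A ONE-STEP OPERATOR** `M : Ω¹(T^{(j)}) → Ω¹(T^{(j+1)})`. [cite: Balaban1987RG1, (0.4) p.253] -/
def segOp (a : PBond P j → ℝ) : PBond P (j + 1) → ℝ := fun c => segMean a c

/-- **THE ITERATED SEGMENT MEAN** `M^s` from level `0` to level `s`. [cite: Balaban1987RG1, (0.11) p.253] -/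
def segIter : (s : ℕ) → (PBond P 0 → ℝ) → (PBond P s → ℝ)
  | 0 => id
  | s + 1 => fun a => segOp (segIter s a)

/-- **THE COBOUNDARY POTENTIAL** `Ψ_s(a)` (a 0-form on `T^{(s)}`): `Ψ₀ = 0`, `Ψ_{s+1} = ptMean Ψ_s + Φ(linAvgIter s a)`. [cite: Balaban1987RG1, (0.4) p.253 (bookkeeping)] -/
def psiIter : (s : ℕ) → (PBond P 0 → ℝ) → (Site P s → ℝ)
  | 0 => fun _ _ => 0
  | s + 1 => fun a y => ptMean (psiIter s a) y + stairMean (linAvgIter s a) y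

/-- `M (dg) = d(ptMean g)` as operators. [cite: Balaban1987RG1, (0.4) p.253] -/
theorem segOp_dgrad (g : Site P j → ℝ) : segOp (dgrad g) = dgrad (fun y => ptMean g y) := by
  funext c; exact segMean_dgrad g c

/-- `M` is linear: subtraction. [folklore] -/
theorem segOp_sub (a b : PBond P j → ℝ) : segOp (a - b) = segOp a - segOp b := by
  funext c; exact segMean_sub a b c

/-- **★★ THE ITERATED (0.4) LINEAR AVERAGE IS THE ITERATED SEGMENT MEAN MINUS A COBOUNDARY**: `linAvgIter s a = M^s a − d(Ψ_s a)`. [cite: Balaban1987RG1, (0.4)+(0.11) p.253] -/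
theorem linAvgIter_eq_segIter_sub (a : PBond P 0 → ℝ) : ∀ s : ℕ, linAvgIter s a = segIter s a - dgrad (psiIter s a)
  | 0 => by
    funext b
    simp only [linAvgIter, segIter, psiIter, id, Pi.sub_apply, dgrad, sub_self, sub_zero]
  | s + 1 => by
    have ih := linAvgIter_eq_segIter_sub a s
    funext c
    rw [linAvgIter_succ, Pi.sub_apply, linAvg04_eq]
    -- the segment mean of `linAvgIter s a = M^s a − dΨ_s`
    have hseg : segMean (linAvgIter s a) c = segIter (s + 1) a c - dgrad (fun y => ptMean (psiIter s a) y) c := by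
      rw [ih, segMean_sub, segMean_dgrad]
      rfl
    rw [hseg]
    simp only [dgrad, psiIter]
    ring

/-- The pure-gauge freedom of the segment mean: `M^s (dg) = d(ptMean^s g)`, so in particular adding a gradient to a one-form changes `M^s` by a gradient. Stated in the form used
by the lift: `M^s (a − dg) = M^s a − M^s(dg)`. [folklore] -/
theorem segIter_sub (a b : PBond P 0 → ℝ) : ∀ s : ℕ, segIter s (a - b) = segIter s a - segIter s b
  | 0 => rfl
  | s + 1 => by
    show segOp (segIter s (a - b)) = segOp (segIter s a) - segOp (segIter s b)
    rw [segIter_sub a b s, segOp_sub]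

end Summit.QuantumFields.YangMills.Theorems.LinearLiftGauge

end
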